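import Summits.HodgeConjecture.HodgeConjecture.Theses.PadicSemiregularLift
import Literature.AlgebraicGeometry.Motives.VarietiesUnitProofs
import Literature.AlgebraicGeometry.Motives.VarietiesDimensionProofs
import Literature.AlgebraicGeometry.Motives.VarietiesProjectiveSpaceProofs
import Literature.NumberTheory.Transcendental.AnalytificationProjProofs

/-!
# Disproof of `HodgeBeyondAnchors` (crux stmt-HodgeConjecture-14054) — findings

Work file of the crux disprover (refuter-cdisprove-stmt-HodgeConjecture-14054-0, cycle 1,
2026-08-16). Prose lives in docstrings; every `theorem` below is kernel-checked unless it carries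
`sorry` (near-misses, §4 only).

## 0. What the crux says, and why no honest kill exists

`HodgeBeyondAnchors` = the Hodge conjecture (`HodgeTheory.HodgeConjectureFor n X`) for every
smooth projective `X/ℂ` of dimension `n` that is not an anchor (not `A.X` of an `n`-dimensional
abelian variety, not a Fermat hypersurface). It is SUMMIT-COMPLETE:

* `hodgeBeyondAnchors_of_hodgeConjecture` (§1, one line): the summit implies the crux, so
  `¬ HodgeBeyondAnchors → ¬ HodgeConjecture` (`not_hodgeConjecture_of_not`): any refutation of the
  crux as typed refutes the AUDITED summit statement — i.e. is either a counterexample to the Hodge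
  conjecture or a typing bug of `Summits/HodgeConjecture/HodgeConjecture/Statement.lean`;
* conversely the tree already has `HodgeBeyondAnchors ↔ HodgeConjecture` modulo named facts
  (`Theorems/PadicSemiregularLiftHodgeBeyondAnchorsEquivalence.lean`, p85575: `X ↦ X × ℙ¹ × ℙ¹`
  is never an anchor, `…ProductsNotAnchors.lean`, and HC descends from `X × ℙ¹ × ℙ¹` to `X`), and
  unconditionally `HodgeConjecture ↔ HodgeAbelianVarieties ∧ HodgeFermatVarieties ∧
  HodgeBeyondAnchors` (p77837).

So the anchor exclusions are NOT load-bearing (dropping them gives an equivalent statement), and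
a disproof must produce a non-algebraic Hodge class. Candidate families named in the route file and
the barrier catalogue, none a theorem in either direction (own `lit search` this session:
search-degraded, searchd rc 75): Weil classes on very general Weil-type abelian varieties of
dimension ≥ 6 (MoonenZarhin1999; dimension 4 settled positively, Markman2025SecantWeil
arXiv:2502.03415) — transported off the anchors by `× ℙ¹ × ℙ¹`
(`Theorems/PadicSemiregularLiftHodgeBeyondAnchorsProductsNotAnchors.lean`); Hodge classes on
self-products of K3 surfaces with real multiplication (`Cruxes/HodgeBeyondAnchors/IdeatorOneNotes.md`
§3 O3); the residual sign classes on Fermat `X⁴₃₃`, `X⁴₃₅` (crux chain of `HodgeFermatVarieties`,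
themselves anchors — but their blow-ups / products are not). Every one of them is OPEN, not false:
the crux "resists because it is HC" (`ledger negatives`: 2 unrelated entries on 2026-08-16 per
`IdeatorOneNotes.md` §1; the call timed out in this session; payload `negatives_index` /
`dossier_path` files do not exist on this hub).

## 1. Summit-completeness (`§ Summit`)

## 2. Load-bearing analysis of the hypotheses (`§ LoadBearing`)

LANDED (p99636, accepted 2026-08-16): the whole section, sorry-free, as
`Summits/HodgeConjecture/HodgeConjecture/Theorems/HodgeBeyondAnchors/Negative/FalseWithoutIsSmoothProjective.lean`
(namespace `Summit.HodgeConjecture.HodgeConjecture.Theorems.HodgeBeyondAnchors.Negative`; importable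
by ideators / planners / leads).

The crux has three hypotheses: `IsSmoothProjective n X`, the abelian exclusion, the Fermat
exclusion. The two exclusions are cosmetic (§0). `IsSmoothProjective n X` is load-bearing FOR THE
TYPING through the anti-vacuity conjunct `Nonempty (HodgeModel n X)` of `HodgeConjectureFor`:
a Hodge model is charted on a complex model space of `finrank = n` and is homeomorphic to `X(ℂ)`,
so the index `n` must be the dimension of `X`. Kernel-checked witness: the point
`pt := 𝟙_ (SchemeOver ℂ) = Spec ℂ`, a genuine smooth projective variety of dimension `0`
(`isSmoothProjective_unit_holds`), read with the wrong index `n = 1`: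

* `isEmpty_hodgeModel_unit`     — `HodgeModel d pt` is empty for `d ≥ 1` (a one-point manifold
  cannot be charted on a positive-dimensional normed space: the chart image of the point would be
  an open singleton);
* `not_hodgeConjectureFor_unit`  — hence `¬ HodgeConjectureFor d pt` for `d ≥ 1`;
* `abelianVariety_X_ne_unit`     — `pt` is not `A.X` for an abelian variety of dimension `≥ 1`
  (`schemeDim pt = 0`, `schemeDim_eq_holds`);
* `not_isFermatVariety_succ_unit` — `pt` is not a Fermat variety `V₊(x₀ᵐ + ⋯ + x_{d+2}ᵐ) ⊂ ℙᵈ⁺²`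
  (`m = 0`: `V₊(d + 3) = ∅`; `m ≥ 1`: `[1 : ζ : 0 : ⋯] ≠ [1 : 0 : ζ : ⋯]`, `ζᵐ = -1`, are two points
  of the zero locus, but a closed immersion from the one-point scheme has one-point range);
* `hodgeBeyondAnchors_false_without_isSmoothProjective` — dropping `IsSmoothProjective` makes the
  crux FALSE (junk, via the anti-vacuity conjunct only);
* `hodgeBeyondAnchors_false_with_decoupled_index` — sharper: even over GENUINE smooth projective
  varieties the conclusion's index must be the variety's dimension
  (`¬ ∀ n n' X, IsSmoothProjective n' X → … → HodgeConjectureFor n X`).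

These refutations bite only `Nonempty (HodgeModel n X)`, never the cycle clause: they say nothing
about Hodge classes. On paper (not formalisable today): dropping PROJECTIVITY alone also breaks
the typing for the wrong reason (`𝔾ₘ`: `[dz/z]` and `[dz̄/z̄] = -[dz/z]` make `H^{1,0} = H^{0,1} =
H¹_dR(ℂˣ)`, so `isInternal_hodgePQ` fails and `HodgeModel 1 𝔾ₘ = ∅`); dropping SMOOTHNESS breaks it
for normal singular `X` (a holomorphic homeomorphism from a manifold onto a normal analytic space
is biholomorphic, so no Hodge model); dropping GEOMETRIC IRREDUCIBILITY changes nothing (HC for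
`X₁ ⊔ X₂` is HC for the components).

## 3. Natural strengthenings known to be false (paper, catalogued barriers)

Integral coefficients (`Literature.Barriers.HodgeConjecture.AtiyahHirzebruch1962_torsionClass_notAlgebraic`,
`Kollar1992_nonTorsionClass_notAlgebraic`), Kähler instead of projective
(`Voisin2002_weilTorus_hodgeClassWithoutSubvarieties`, Zucker), generalized HC without
Grothendieck's amendment — all outside the typed crux (ℚ-span, projective, classical HC).

## 4. Near-misses / not attempted

No `sorry` in this file. Not attempted: an exotic `HodgeModel` (the `∃`-over-models in
`IsOfHodgeType` can only ENLARGE the set of Hodge classes; `IsAnalytification` pins the complex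
structure by Osgood, `RationalHodgeClasses` module docstring) — no constructible instance.

## 5. Line `Sketch` (lead prover-line-stmt-HodgeConjecture-14054-0)

Declared dead at L0 by the lead (`Cruxes/HodgeBeyondAnchors/Lines/Sketch-dead.md`): no `stub_*`,
no `HodgeBeyondAnchors_of`; nothing to attack. Joint-sufficiency remark recorded there (§3, card
Transfer `C⁺ := VAR ∧ RIG`): `RIG` is HC on a sub-class with no lever — consistent with §0 here
(no reduction of HC to a proper subclass of varieties is known beyond bookkeeping).
-/

set_option linter.dupNamespace false

noncomputable section

open CategoryTheory AlgebraicGeometry MonoidalCategory CartesianMonoidalCategory Topology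
open scoped Manifold
open Literature.AlgebraicGeometry.Motives Literature.AlgebraicGeometry.HodgeTheory
open Literature.NumberTheory.Transcendental

namespace Summit.HodgeConjecture.HodgeConjecture.Cruxes.HodgeBeyondAnchors.Disproof

open Summit.HodgeConjecture.HodgeConjecture.Theses.PadicSemiregularLift

/-! ## §1 Summit-completeness -/

section Summit

/-- The summit statement implies the crux (forget the anchor exclusions). [folklore] -/
theorem hodgeBeyondAnchors_of_hodgeConjecture (h : _root_.HodgeConjecture) : HodgeBeyondAnchors :=
  fun _ _ hX _ _ ↦ h hX

/-- Contrapositive: a refutation of the crux as typed refutes the audited summit statement.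
[folklore] -/
theorem not_hodgeConjecture_of_not (h : ¬ HodgeBeyondAnchors) : ¬ _root_.HodgeConjecture :=
  fun hc ↦ h (hodgeBeyondAnchors_of_hodgeConjecture hc)

end Summit

/-! ## §2 Load-bearing analysis: the index `n` / `IsSmoothProjective n X` -/

section LoadBearing

/-- The witness: the point `Spec ℂ`, as the monoidal unit of `SchemeOver ℂ`. [folklore] -/
abbrev pt : SchemeOver ℂ := 𝟙_ (SchemeOver ℂ)

/-- `Spec ℂ` has exactly one complex point (it is terminal in `SchemeOver ℂ`). [folklore] -/
instance subsingleton_complexPoints_pt : Subsingleton (ComplexPoints pt) :=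
  inferInstanceAs (Subsingleton (specOver ℂ ℂ ⟶ 𝟙_ (SchemeOver ℂ)))

/-- `Spec ℂ` has a complex point. [folklore] -/
instance nonempty_complexPoints_pt : Nonempty (ComplexPoints pt) := ⟨toUnit _⟩

/-- **No Hodge model of the point in positive dimension.** A Hodge model of `pt` read in dimension
`d` is a complex manifold charted on a model space `E` with `finrank ℂ E = d`, homeomorphic to the
one-point space `pt(ℂ)`; for `d ≥ 1` the chart image of its point would be an open singleton of the
non-trivial normed space `E`. [folklore] -/
theorem isEmpty_hodgeModel_unit {d : ℕ} (hd : 1 ≤ d) : IsEmpty (HodgeModel d pt) := by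
  refine ⟨fun A ↦ ?_⟩
  have hφ := A.isAnalytification.isHomeomorph
  haveI : Subsingleton A.carrier := hφ.injective.subsingleton
  obtain ⟨m, -⟩ := hφ.surjective (toUnit _)
  haveI : Nontrivial A.model :=
    Module.nontrivial_of_finrank_pos (R := ℂ) (by rw [A.isAnalytification.finrank_eq]; omega)
  haveI := Module.punctured_nhds_neBot ℂ A.model
  set e := chartAt A.model m
  have hopen : IsOpen ({m} : Set A.carrier) := by
    have : ({m} : Set A.carrier) = Set.univ := Set.eq_univ_of_forall fun x ↦ Subsingleton.elim x m
    rw [this]; exact isOpen_univ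
  have himg : IsOpen (e '' {m}) :=
    e.isOpen_image_of_subset_source hopen (Set.singleton_subset_iff.2 (mem_chart_source _ m))
  rw [Set.image_singleton, isOpen_singleton_iff_punctured_nhds] at himg
  exact (inferInstance : Filter.NeBot (𝓝[≠] (e m))).ne himg

/-- Hence the Hodge conjecture "for `pt` in dimension `d ≥ 1`" is FALSE as typed: its anti-vacuity
conjunct `Nonempty (HodgeModel d pt)` fails. [folklore] -/
theorem not_hodgeConjectureFor_unit {d : ℕ} (hd : 1 ≤ d) : ¬ HodgeConjectureFor d pt :=
  fun h ↦ (isEmpty_hodgeModel_unit hd).false h.1.some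

/-- Tightness of the tree's named fact `HodgeTheory.nonempty_hodgeModel`
(`IsSmoothProjective n X → Nonempty (HodgeModel n X)`): its hypothesis cannot be dropped, not even
weakened to "`X` smooth projective of SOME dimension". [folklore] -/
theorem not_forall_nonempty_hodgeModel :
    ¬ ∀ (n : ℕ) (X : SchemeOver ℂ), IsSmoothProjective 0 X → Nonempty (HodgeModel n X) :=
  fun h ↦ (isEmpty_hodgeModel_unit le_rfl).false (h 1 pt (isSmoothProjective_unit_holds ℂ)).some

/-- `pt` has dimension `0`. [folklore] -/
theorem schemeDim_pt : schemeDim pt.left = 0 :=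
  schemeDim_eq_holds (isSmoothProjective_unit_holds ℂ)

/-- `pt` is not the underlying scheme of an abelian variety of positive dimension. [folklore] -/
theorem abelianVariety_X_ne_unit {d : ℕ} (hd : 1 ≤ d) (A : AbelianVariety ℂ) (hA : A.dim = d) :
    A.X ≠ pt := by
  intro h
  have h0 : A.dim = 0 := by
    show schemeDim A.X.left = 0
    rw [h]; exact schemeDim_pt
  omega

/-- At `m = 0` the Fermat form is the non-zero constant `N + 2`, a unit. [folklore] -/
theorem isUnit_fermatPolynomial_zero (N : ℕ) : IsUnit (fermatPolynomial ℂ N 0) := by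
  have h : fermatPolynomial ℂ N 0 = ((N + 2 : ℕ) : MvPolynomial (Fin (N + 2)) ℂ) := by
    simp only [fermatPolynomial, pow_zero, Finset.sum_const, Finset.card_univ, Fintype.card_fin,
      nsmul_eq_mul, mul_one]
  rw [h, ← map_natCast (algebraMap ℂ (MvPolynomial (Fin (N + 2)) ℂ))]
  refine IsUnit.map _ ?_
  rw [isUnit_iff_ne_zero]
  exact_mod_cast Nat.succ_ne_zero (N + 1)

/-- The underlying space of `pt = Spec ℂ` is one point. [folklore] -/
instance subsingleton_pt_left : Subsingleton ↥pt.left :=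
  inferInstanceAs (Subsingleton (PrimeSpectrum ℂ))

/-- The underlying space of `pt = Spec ℂ` is non-empty. [folklore] -/
instance nonempty_pt_left : Nonempty ↥pt.left :=
  inferInstanceAs (Nonempty (PrimeSpectrum ℂ))

/-- `F(v) = Σ vᵢᵐ` for the Fermat form `F = Σ xᵢᵐ`. [folklore] -/
theorem eval_fermatPolynomial (n m : ℕ) (v : Fin (n + 2) → ℂ) :
    MvPolynomial.eval v (fermatPolynomial ℂ n m) = ∑ i, v i ^ m := by
  simp [fermatPolynomial]

/-- **`pt` is not a Fermat variety of positive dimension.** `IsFermatVariety (d + 1) m pt` would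
give a closed immersion `ι : Spec ℂ → ℙᵈ⁺²` with one-point range equal to
`V₊(x₀ᵐ + ⋯ + x_{d+2}ᵐ)`; for `m = 0` that zero locus is empty (`V₊(d + 3)`), for `m ≥ 1` it
contains the two distinct points `[1 : ζ : 0 : ⋯]`, `[1 : 0 : ζ : 0 : ⋯]`, `ζᵐ = -1`. [folklore] -/
theorem not_isFermatVariety_succ_unit (d m : ℕ) : ¬ IsFermatVariety (d + 1) m pt := by
  letI := MvPolynomial.gradedAlgebra (σ := Fin (d + 1 + 1 + 1)) (R := ℂ)
  rintro ⟨_, ι, _, hrange⟩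
  rcases Nat.eq_zero_or_pos m with rfl | hm
  · -- `V₊(unit) = ∅` but the range is non-empty
    obtain ⟨x⟩ := (inferInstance : Nonempty ↥pt.left)
    have hx : ι.left.base x ∈ Set.range ι.left.base := ⟨x, rfl⟩
    rw [hrange] at hx
    have hx' : fermatPolynomial ℂ (d + 1) 0 ∈
        (ι.left.base x : ProjectiveSpectrum
          (MvPolynomial.homogeneousSubmodule (Fin (d + 1 + 1 + 1)) ℂ)).asHomogeneousIdeal :=
      Set.singleton_subset_iff.1 ((ProjectiveSpectrum.mem_zeroLocus _ _ _).1 hx)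
    exact (ι.left.base x : ProjectiveSpectrum _).isPrime.ne_top
      (Ideal.eq_top_of_isUnit_mem _ hx' (isUnit_fermatPolynomial_zero (d + 1)))
  · -- two points of the zero locus
    obtain ⟨ζ, hζ⟩ : ∃ ζ : ℂ, ζ ^ m = -1 := IsAlgClosed.exists_pow_nat_eq (-1) hm
    have hζ0 : ζ ≠ 0 := by
      rintro rfl
      rw [zero_pow hm.ne'] at hζ
      exact one_ne_zero (neg_eq_zero.1 hζ.symm)
    have hF : fermatPolynomial ℂ (d + 1) m ∈
        MvPolynomial.homogeneousSubmodule (Fin (d + 1 + 1 + 1)) ℂ m :=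
      (MvPolynomial.mem_homogeneousSubmodule m _).2 (isHomogeneous_fermatPolynomial (d + 1) m)
    -- membership of `[v]` in the range, from `F(v) = 0`
    have hmem : ∀ (v : Fin (d + 1 + 1 + 1) → ℂ) (hv : v ≠ 0),
        MvPolynomial.eval v (fermatPolynomial ℂ (d + 1) m) = 0 →
        (projPoint (d + 1 + 1) (Projectivization.mk ℂ v hv)).pt ∈ Set.range ι.left.base := by
      intro v hv hv0
      rw [hrange]
      refine (ProjectiveSpectrum.mem_zeroLocus _ _ _).2 (Set.singleton_subset_iff.2 ?_)
      by_contra hnot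
      exact ((pt_projPoint_mk_mem_basicOpen_iff (d + 1 + 1) v hv hm hF).1
        ((Proj.mem_basicOpen _ _ _).2 hnot)) hv0
    -- the two vectors, at the native type of the Fermat form
    have h1 : (Matrix.vecCons 1 (Matrix.vecCons ζ 0) : Fin (d + 1 + 2) → ℂ) ≠ 0 :=
      fun h ↦ by simpa using congr_fun h 0
    have h2 : (Matrix.vecCons 1 (Matrix.vecCons 0 (Matrix.vecCons ζ 0)) : Fin (d + 1 + 2) → ℂ) ≠ 0 :=
      fun h ↦ by simpa using congr_fun h 0
    have hz1 : MvPolynomial.eval (Matrix.vecCons 1 (Matrix.vecCons ζ 0) : Fin (d + 1 + 2) → ℂ)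
        (fermatPolynomial ℂ (d + 1) m) = 0 := by
      rw [eval_fermatPolynomial, Fin.sum_univ_succ, Fin.sum_univ_succ]
      simp [hζ, zero_pow hm.ne']
    have hz2 : MvPolynomial.eval
        (Matrix.vecCons 1 (Matrix.vecCons 0 (Matrix.vecCons ζ 0)) : Fin (d + 1 + 2) → ℂ)
        (fermatPolynomial ℂ (d + 1) m) = 0 := by
      rw [eval_fermatPolynomial, Fin.sum_univ_succ, Fin.sum_univ_succ, Fin.sum_univ_succ]
      simp [hζ, zero_pow hm.ne']
    obtain ⟨a, ha⟩ := hmem _ h1 hz1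
    obtain ⟨b, hb⟩ := hmem _ h2 hz2
    obtain rfl : a = b := Subsingleton.elim a b
    have hpt := ha.symm.trans hb
    haveI := (isSmoothProjective_projectiveSpace_holds ℂ (d + 1 + 1)).smoothOfRelativeDimension
    haveI : Smooth (projectiveSpace (d + 1 + 1) ℂ).hom :=
      SmoothOfRelativeDimension.smooth (d + 1 + 1) _
    have heq := projPoint_injective (d + 1 + 1)
      (Literature.AlgebraicGeometry.Motives.ComplexPoints.ext_of_pt_eq hpt)
    rw [Projectivization.mk_eq_mk_iff] at heq
    obtain ⟨u, hu⟩ := heq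
    have hu1 := congr_fun hu 1
    simp only [Pi.smul_apply, Matrix.cons_val_one, Matrix.cons_val_zero, smul_zero] at hu1
    exact hζ0 (by simpa using hu1.symm)

/-- **`IsSmoothProjective` is load-bearing (for the typing).** Dropping it from the crux gives a
FALSE statement: the point read in dimension `1` satisfies both anchor exclusions and fails
`HodgeConjectureFor 1` through the anti-vacuity conjunct. Any proof of the crux must use
`IsSmoothProjective n X` — at least its consequence `schemeDim X = n`. [folklore] -/
theorem hodgeBeyondAnchors_false_without_isSmoothProjective :
    ¬ ∀ ⦃n : ℕ⦄ ⦃X : SchemeOver ℂ⦄,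
      (∀ A : AbelianVariety ℂ, A.dim = n → A.X ≠ X) →
      (∀ m : ℕ, ¬ IsFermatVariety n m X) → HodgeConjectureFor n X :=
  fun h ↦ not_hodgeConjectureFor_unit le_rfl
    (h (abelianVariety_X_ne_unit le_rfl) (not_isFermatVariety_succ_unit 0))

/-- **The conclusion's index is load-bearing even over genuine smooth projective varieties.**
Decoupling the dimension index of the hypothesis from that of the conclusion gives a FALSE
statement (witness: the smooth projective `0`-fold `pt`, conclusion read with `n = 1`).
[folklore] -/
theorem hodgeBeyondAnchors_false_with_decoupled_index :
    ¬ ∀ ⦃n n' : ℕ⦄ ⦃X : SchemeOver ℂ⦄, IsSmoothProjective n' X →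
      (∀ A : AbelianVariety ℂ, A.dim = n → A.X ≠ X) →
      (∀ m : ℕ, ¬ IsFermatVariety n m X) → HodgeConjectureFor n X :=
  fun h ↦ not_hodgeConjectureFor_unit le_rfl
    (h (isSmoothProjective_unit_holds ℂ) (abelianVariety_X_ne_unit le_rfl)
      (not_isFermatVariety_succ_unit 0))

/-- Consistency check in the other direction: WITH the hypothesis, the index is the dimension
(`schemeDim_eq_holds`), so the witness above is excluded exactly by `IsSmoothProjective 1 pt`
being false. [folklore] -/
theorem not_isSmoothProjective_one_unit : ¬ IsSmoothProjective 1 pt := fun h ↦ by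
  have h1 : schemeDim pt.left = 1 := schemeDim_eq_holds h
  rw [schemeDim_pt] at h1
  exact zero_ne_one h1

end LoadBearing

end Summit.HodgeConjecture.HodgeConjecture.Cruxes.HodgeBeyondAnchors.Disproof

end
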